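import Mathlib
import HarnessLib
import Summits.CriticalPhenomena.SAWScalingLimit.Theses.SAWEdgeOfPositiveType

/-!
# Birth skeleton for the crux `SAWEdgeOfPositiveType.ConvexMetricTriangle` (stmt-CriticalPhenomena-13962)

Route `route-CriticalPhenomena-SAWEdgeOfPositiveType` (sub-problem `SAWScalingLimit`), crux #2 (rank 2,
LOAD-BEARING in `closes`): for every convex `K ⊆ ℂ`, every finite lattice trace `Λ` of `K`
(`z ∈ Λ ↔ z ∈ K`), every `x ∈ [0, x_c]` and all `a b c ∈ Λ` with `Z(a,b), Z(b,c) > 0`,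
`√(−log Z(a,c)) ≤ √(−log Z(a,b)) + √(−log Z(b,c))`, where `Z = Z^Λ_x` is the confined-SAW polymer
kernel (`kernel` below is VERBATIM the crux's `let Z`).  Registered by the skeleton registrar
`planner-skel-stmt-CriticalPhenomena-13962-0` (2026-08-17, route re-audit bin REPAIRABLE); published
as `Cruxes/ConvexMetricTriangle/Lines/birth.lean`.

## The line in one paragraph — "the binding triple is short" (the route's foreseen split
BulkTriple/BoundaryRelief of #2, retyped so that it is correct at every order in `x`)

Write `slack(a,b,c) := √F(a,b) + √F(b,c) − √F(a,c)`, `F = −log Z^Λ_x`; the crux says `slack ≥ 0`.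
A triple is SHORT when `b` is a lattice neighbour of both `a` and `c` (so `a − c ∈ {±2e, ±e ± e'}` or
`a = c`): the lattice-scale configurations.  The line has two registered pieces of different nature:

* **S1 `stub_shortTriangle` (the LATTICE-SCALE CRUX; open, hardest numerically):** `slack ≥ 0` for
  every short triple of every convex lattice trace at every `x ∈ [0, x_c]` — i.e. the family of
  nearest-neighbour / distance-two inequalities `Z^Λ_x(a,c) ≥ Z^Λ_x(a,b)·Z^Λ_x(b,c)·exp(−2√(F(a,b)F(b,c)))`
  whose bulk member is the route's CHEAPEST FALSIFIER `G_x(2e₁) ≥ G_x(e₁)⁴` (series estimates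
  0.46–0.65 vs 0.42–0.43 at `x_c`).  This is where certified numerics, series and transfer matrices
  bite (finite range in two of the three pairs), and where the margin is thinnest.
* **S2 `stub_shortExtremality` (EXTREMALITY; open near `x_c`, robust for small `x`):** every
  NON-DEGENERATE triple (`b ∉ {a, c}`) with positive legs is dominated by a short triple of the same
  domain at the same fugacity: `∃` short `(a',b',c') ⊆ Λ` with positive legs and
  `slack(a',b',c') ≤ slack(a,b,c)` — "the minimum of the √F-slack over a convex lattice domain is
  attained at the lattice scale".  Why plausible: as `x → 0⁺`, `F(u,v) = d_Λ(u,v)·L − log N_Λ(u,v) + O(x²)`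
  (`L = −log x`, `d_Λ` the induced graph metric, `N_Λ` the geodesic count), so
  `slack = √L·(√d_ab + √d_bc − √d_ac) + O(L^{-1/2})` and `g := √d_ab + √d_bc − √d_ac` over lattice
  triples with `d_ac ≤ d_ab + d_bc` is minimised EXACTLY at `(d_ab, d_bc, d_ac) = (1,1,2)` (value
  `2 − √2 = 0.586`, next value `1 + √2 − √3 = 0.682`), i.e. at short triples, with a gap of order `√L`
  that dominates the corrections (long thin triples are controlled by the one-step extension bound
  `F(a,c) ≤ F(a,b) + L + log 2` for `b ~ c`, which follows from `Z(a,b) ≤ Z(a,c)/x + Z(a,c)Z(c,b)`);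
  at `x_c` it is the statement behind the route's observation "near `x_c` the binding triples are
  adjacent collinear bulk sites" (dossier of stmt-CriticalPhenomena-8258: minimum MT slack 0.512 … 0.471
  on 3×3 … 6×6 boxes, ≈ 0.45 at the 9×9 centre, always at an adjacent collinear triple).  NOTE the
  correction to the route's informal "BoundaryRelief": at order `x²` a boundary-row short triple has
  LESS slack than a bulk one (the registrar's expansion: `−0.06·x²/√L`), and at an acute corner the
  corner-type short triple ties with the collinear one at order `x²` — so the comparator class must be
  ALL short triples (bulk, boundary, collinear or corner), which is how S1/S2 are typed.

  ConvexMetricTriangle ⇐ (degenerate triples: `√ ≥ 0`) ∧ (non-degenerate: S2 ↦ a short comparator, S1 on it)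

`ConvexMetricTriangle_of` (no `sorry`) performs exactly this case analysis and concludes the crux BY
NAME; `sorry` occurs only inside the two `stub_*`; hypotheses are the name-keyed aliases
`Registered.stub_*` (device of `Cruxes/SubCurvatureTightness/Lines/birth.lean`).

Why this cut and not another (registrar's notes, NOTES.md §Design): (i) the Schoenberg branch
(`ConvexInfiniteDivisibility → ConvexMetricTriangle`, support `SchoenbergToMetric`, PROVED) is already
wired as route items — a stub equal to crux #4 would be closed against the crux by `exact?` through
that support, i.e. no skeleton; (ii) the additive split "bulk `−log G_x` is of negative type" +
"the confinement penalty `log(G_x/Z^Λ_x)` is of negative type" is FALSE already at leading order on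
the convex trace `{0, e₁, e₂}` (penalty kernel `(0,0,log 2)` with weights `(−2,1,1)` gives `+2 log 2`);
(iii) regime splits in `x` or in the masses either hide the whole crux in one piece or need
hand-picked constants (CRUX TYPING CHECKLIST (iv)).  The present cut has no constants, two pieces of
different kind (a lattice-scale inequality family / an extremality principle), each independently
falsifiable: S1 by the route's series programme (kit j000466) or one certified short triple in one
box at rational `x ≤ 1/2.695`; S2 by exhaustive enumeration (a non-short minimiser of the slack in any
convex trace at any `x ≤ x_c` kills it).

## Toy evidence (registrar, local, `toy/short_extremal.py`, exhaustive SAW enumeration)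

15 convex traces (boxes 2×2 … 4×5, lattice triangles of side 3–5, the ℓ¹-diamond of radius 2, a
21-site disc, a width-1 staircase, a slope-1/2 slab) × `x ∈ {0.05, 0.2, 0.3, 0.35, x_c = 0.379052}`:
in 75/75 cases the minimum slack over ALL non-degenerate positive triples is attained at a SHORT
triple (S2 holds with equality of minima) and is positive (S1 holds): min slack 1.014 (x = 0.05,
boundary-row collinear), 0.73–0.74 (x = 0.2), 0.49–0.58 (x = x_c; bulk-row collinear on boxes,
e.g. 0.4995 on 4×4 at ((3,1),(2,1),(1,1)), 0.4865 on the 21-site disc at ((1,0),(0,0),(−1,0))).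
Largest off-diagonal `Z` seen: 0.568 (< 1, so `Real.sqrt` never truncates in these runs).

## BC3 audit (registrar, 2026-08-17; raw outputs in the registrar's NOTES.md `birth-certificate:`)

* `lean check --json` of this file: rc 0, sorries = 2 = stubs (`stub_shortTriangle`,
  `stub_shortExtremality`), zero elsewhere; `ConvexMetricTriangle_of` and the wiring `example` are
  sorry-free and conclude `Summit.CriticalPhenomena.SAWScalingLimit.Theses.SAWEdgeOfPositiveType.ConvexMetricTriangle`.
* Probes (`bc/probe_shortTriangle.lean`, `bc/probe_shortExtremal.lean`, same vocabulary,
  `set_option maxHeartbeats 400000`, `first | exact? | simpa | aesop` and the BC.md variant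
  `first | exact? | simpa [defs] | (unfold; simpa) | aesop`): `stub → ConvexMetricTriangle` FAILS and
  `stub → _root_.SAWScalingLimit` FAILS for both stubs (8/8 tactic failures) — no stub is cheaply the
  crux or the summit.  (S1 is a strict special case of the crux — short triples only; S2 is neither
  implied by nor implies the crux: it asserts WHERE the minimum sits, not its sign.)

## Disproof used / dead lines / negatives

No `Cruxes/ConvexMetricTriangle/Disproof.lean`, no `Lines/*`, no crux ideas existed at registration
(`ledger crux ls stmt-CriticalPhenomena-13962`: no workfiles).  `ledger negatives --problem
CriticalPhenomena` (11 entries): the only one touching this route is stmt-CriticalPhenomena-8261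
(ALL-`Λ` infinite divisibility, refuted on the two-hole trace `theta(8,2)` at `x = 1/16, t = 1/256`);
both stubs here carry the crux's convexity hypothesis verbatim and are three-point statements
(blind to the 5-point theta/`K₂,₃` obstruction), so neither is an instance of the refuted statement.
-/

noncomputable section

open scoped BigOperators Topology Classical
open Literature.Probability.LatticeModels
open Summit.CriticalPhenomena.SAWScalingLimit.Theses.SAWEdgeOfPositiveType (ConvexMetricTriangle)

namespace Summit.CriticalPhenomena.SAWScalingLimit.Cruxes.ConvexMetricTriangle.Birth

/-! ## §0 Vocabulary of the line -/

/-- **The confined-SAW polymer kernel `Z^Λ_x(u,v)`** — VERBATIM the `let Z` of the crux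
`SAWEdgeOfPositiveType.ConvexMetricTriangle`: the sum over self-avoiding walks `u → v` with all
sites in `Λ` of `x^(length)` (lengths `< |Λ|` suffice; unit diagonal).  Named only to keep the stub
signatures short; `ConvexMetricTriangle_of` checks definitionally that it IS the crux's kernel.
[route SAWEdgeOfPositiveType, item stmt-CriticalPhenomena-13962] -/
def kernel (Λ : Finset (Site 2)) (x : ℝ) (u v : Site 2) : ℝ :=
  ∑ n ∈ Finset.range Λ.card,
    ∑ _ω ∈ (Literature.Probability.RandomPlanarGeometry.SAW.Zd.sawFun 2 n (v - u)).filter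
      (fun ω => ∀ i ≤ n, u + ω i ∈ Λ), x ^ n

/-- **The √F-slack of a triple**: `√(−log Z(a,b)) + √(−log Z(b,c)) − √(−log Z(a,c))`; the crux says
it is `≥ 0` on positive-leg triples of convex lattice traces for `x ≤ x_c`. -/
def slack (Λ : Finset (Site 2)) (x : ℝ) (a b c : Site 2) : ℝ :=
  Real.sqrt (-Real.log (kernel Λ x a b)) + Real.sqrt (-Real.log (kernel Λ x b c))
    - Real.sqrt (-Real.log (kernel Λ x a c))

/-- **Statement S1 (the lattice-scale crux): the √F triangle inequality on SHORT triples** — for every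
convex `K`, finite lattice trace `Λ` of `K`, `x ∈ [0, x_c]` and `a b c ∈ Λ` with `b` a lattice
neighbour of both `a` and `c` (`a = c` allowed) and `Z(a,b), Z(b,c) > 0`:
`√(−log Z(a,c)) ≤ √(−log Z(a,b)) + √(−log Z(b,c))`.  The bulk member is `G_x(2e₁) ≥ G_x(e₁)⁴`-type;
the boundary-row and corner members are included (they bind at small `x`). -/
def ShortTriangle : Prop :=
  ∀ (K : Set ℂ), Convex ℝ K → ∀ (Λ : Finset (Site 2)), (∀ z : Site 2, z ∈ Λ ↔ Site.toComplex z ∈ K) →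
    ∀ (x : ℝ), 0 ≤ x → x ≤ Literature.Probability.RandomPlanarGeometry.SAW.criticalFugacity →
    ∀ (a b c : Site 2), a ∈ Λ → b ∈ Λ → c ∈ Λ → (zdGraph 2).Adj a b → (zdGraph 2).Adj b c →
    0 < kernel Λ x a b → 0 < kernel Λ x b c →
    Real.sqrt (-Real.log (kernel Λ x a c)) ≤
      Real.sqrt (-Real.log (kernel Λ x a b)) + Real.sqrt (-Real.log (kernel Λ x b c))

/-- **Statement S2 (extremality: the minimum slack sits at the lattice scale)** — for every convex `K`,
finite lattice trace `Λ`, `x ∈ [0, x_c]` and every NON-DEGENERATE triple `a b c ∈ Λ` (`b ≠ a`,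
`b ≠ c`) with `Z(a,b), Z(b,c) > 0`, some SHORT triple `a' b' c' ∈ Λ` (with `b' ~ a'`, `b' ~ c'`,
positive legs) has `slack(a',b',c') ≤ slack(a,b,c)`.  Vacuous at `x = 0` (then `Z(a,b) > 0` forces
`a = b`); for `x > 0` a comparator always EXISTS (the component of `a, b, c` has a path of length two,
or is the edge `{a, b}` with `c = a`, when `(a, b, a)` itself is short), so the content is the
inequality.  Robust as `x → 0⁺` (gap `(0.682 − 0.586)·√(−log x)`); at `x_c` it is the dossier's
"binding triples are adjacent collinear sites". -/
def ShortExtremal : Prop :=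
  ∀ (K : Set ℂ), Convex ℝ K → ∀ (Λ : Finset (Site 2)), (∀ z : Site 2, z ∈ Λ ↔ Site.toComplex z ∈ K) →
    ∀ (x : ℝ), 0 ≤ x → x ≤ Literature.Probability.RandomPlanarGeometry.SAW.criticalFugacity →
    ∀ (a b c : Site 2), a ∈ Λ → b ∈ Λ → c ∈ Λ → b ≠ a → b ≠ c →
    0 < kernel Λ x a b → 0 < kernel Λ x b c →
    ∃ a' b' c' : Site 2, a' ∈ Λ ∧ b' ∈ Λ ∧ c' ∈ Λ ∧ (zdGraph 2).Adj a' b' ∧ (zdGraph 2).Adj b' c' ∧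
      0 < kernel Λ x a' b' ∧ 0 < kernel Λ x b' c' ∧ slack Λ x a' b' c' ≤ slack Λ x a b c

/-! ## §1 The registered stubs (`sorry` lives ONLY in these two theorems; each restates its named
statement, `*_holds` below certify the agreement definitionally) -/

/-- **STUB S1 · `stub_shortTriangle`** (L–XL, OPEN — thinnest margin) `= ShortTriangle`: the √F
triangle inequality for short triples (b a common lattice neighbour of a and c) in every convex
lattice trace at every `x ∈ [0, x_c]`. -/
theorem stub_shortTriangle :
    ∀ (K : Set ℂ), Convex ℝ K → ∀ (Λ : Finset (Site 2)), (∀ z : Site 2, z ∈ Λ ↔ Site.toComplex z ∈ K) →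
    ∀ (x : ℝ), 0 ≤ x → x ≤ Literature.Probability.RandomPlanarGeometry.SAW.criticalFugacity →
    ∀ (a b c : Site 2), a ∈ Λ → b ∈ Λ → c ∈ Λ → (zdGraph 2).Adj a b → (zdGraph 2).Adj b c →
    0 < kernel Λ x a b → 0 < kernel Λ x b c →
    Real.sqrt (-Real.log (kernel Λ x a c)) ≤
      Real.sqrt (-Real.log (kernel Λ x a b)) + Real.sqrt (-Real.log (kernel Λ x b c)) := by
  sorry

/-- **STUB S2 · `stub_shortExtremality`** (L–XL, OPEN near `x_c`; provable for small `x`)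
`= ShortExtremal`: every non-degenerate positive-leg triple of a convex lattice trace is dominated in
√F-slack by a short triple of the same trace at the same fugacity. -/
theorem stub_shortExtremality :
    ∀ (K : Set ℂ), Convex ℝ K → ∀ (Λ : Finset (Site 2)), (∀ z : Site 2, z ∈ Λ ↔ Site.toComplex z ∈ K) →
    ∀ (x : ℝ), 0 ≤ x → x ≤ Literature.Probability.RandomPlanarGeometry.SAW.criticalFugacity →
    ∀ (a b c : Site 2), a ∈ Λ → b ∈ Λ → c ∈ Λ → b ≠ a → b ≠ c →
    0 < kernel Λ x a b → 0 < kernel Λ x b c →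
    ∃ a' b' c' : Site 2, a' ∈ Λ ∧ b' ∈ Λ ∧ c' ∈ Λ ∧ (zdGraph 2).Adj a' b' ∧ (zdGraph 2).Adj b' c' ∧
      0 < kernel Λ x a' b' ∧ 0 < kernel Λ x b' c' ∧ slack Λ x a' b' c' ≤ slack Λ x a b c := by
  sorry

/-! ### Consistency: each named statement IS its registered stub (definitionally) -/

theorem shortTriangle_holds : ShortTriangle := stub_shortTriangle
theorem shortExtremal_holds : ShortExtremal := stub_shortExtremality

/-! ### Name-keyed aliases of the two statements (the hypotheses of the composition) -/
namespace Registered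

/-- Alias of `ShortTriangle` keyed by the registered stub name. -/
abbrev stub_shortTriangle : Prop := ShortTriangle
/-- Alias of `ShortExtremal` keyed by the registered stub name. -/
abbrev stub_shortExtremality : Prop := ShortExtremal

end Registered

/-! ## §2 The composition: the two stubs imply the crux, BY NAME (kernel-checked; no `sorry` below).
Not a one-line seam: the crux's `let`-bound kernel is identified with `kernel`, the degenerate
triples (`b = a` or `b = c`) are discharged by `Real.sqrt ≥ 0`, and in the non-degenerate case the
short comparator produced by S2 is fed to S1 and the two slack inequalities are chained. -/

/-- **`ConvexMetricTriangle_of`** — STUBS S1–S2 imply `SAWEdgeOfPositiveType.ConvexMetricTriangle`. -/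
theorem ConvexMetricTriangle_of (h1 : Registered.stub_shortTriangle)
    (h2 : Registered.stub_shortExtremality) : ConvexMetricTriangle := by
  intro K hK Λ hΛ x hx0 hxc a b c ha hb hc
  show 0 < kernel Λ x a b → 0 < kernel Λ x b c →
    Real.sqrt (-Real.log (kernel Λ x a c)) ≤
      Real.sqrt (-Real.log (kernel Λ x a b)) + Real.sqrt (-Real.log (kernel Λ x b c))
  intro hab hbc
  by_cases hba : b = a
  · subst hba
    have h0 : 0 ≤ Real.sqrt (-Real.log (kernel Λ x b b)) := Real.sqrt_nonneg _
    linarith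
  by_cases hbc' : b = c
  · subst hbc'
    have h0 : 0 ≤ Real.sqrt (-Real.log (kernel Λ x b b)) := Real.sqrt_nonneg _
    linarith
  -- non-degenerate triple: S2 gives a short comparator, S1 makes its slack nonnegative
  obtain ⟨a', b', c', ha', hb', hc', hadj₁, hadj₂, hpos₁, hpos₂, hle⟩ :=
    h2 K hK Λ hΛ x hx0 hxc a b c ha hb hc hba hbc' hab hbc
  have hshort := h1 K hK Λ hΛ x hx0 hxc a' b' c' ha' hb' hc' hadj₁ hadj₂ hpos₁ hpos₂
  have hslack' : 0 ≤ slack Λ x a' b' c' := by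
    unfold slack
    linarith
  have hslack : 0 ≤ slack Λ x a b c := le_trans hslack' hle
  unfold slack at hslack
  linarith

/-- Wiring check: the registered stubs feed `ConvexMetricTriangle_of` as stated. -/
example : ConvexMetricTriangle := ConvexMetricTriangle_of stub_shortTriangle stub_shortExtremality

end Summit.CriticalPhenomena.SAWScalingLimit.Cruxes.ConvexMetricTriangle.Birth

end
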